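import Mathlib
import Literature.NumberTheory.LFunctions.Zhang2022.TypedSection15AIdentities
import Literature.NumberTheory.LFunctions.Zhang2022.ToolkitDivisorMajorants
import HarnessLib

/-!
# Zhang (2022) §15: holomorphy and a majorant for `κ̃₁(d₁;r,s)` (inputs of the u021 contour step)

Topic `Literature/NumberTheory/LFunctions/Zhang2022` (Landau–Siegel audit tree; verdict-neutral).
Y. Zhang, *Discrete mean estimates and the Landau–Siegel zero*, arXiv:2211.02515v1 (2022)
[Zhang2022LandauSiegel] — **an unrefereed manuscript under adjudication**; nothing here asserts its
Theorems 1–2 (ZHANG-L lane, WP15, node `Z22:§15.u021`, leaf `h15_17`).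

`κ̃₁(d₁;r,s) = Σ_{h∈𝔫(d₁),(h,r)=1} κ₁(d₁h)χ(h)h^{−s}` ((15.9), `Typed.Section15A.kappaTilde1`) is the factor
of the (15.8) integrand that u021 ("in a way similar to the treatment of (7.19)", p. 82, tex L4129)
moves across the strip `9/10 < σ ≤ 2` (engine `DeltaContourShift.deltaContourShift`, zl-libC-p3). This
file supplies, for every `σ₀ > 0`, the analytic inputs on `{σ > σ₀}` (the `h`-sum runs over the
multiplicative semigroup `𝔫(d₁)` generated by the primes of `d₁`, so it converges for every `σ > 0`):

* `summable_tau_rpow_factoredNumbers` — `Σ_{h∈𝔫(S)} τ_j(h)h^{−σ} < ∞` for a finite set of primes `S`,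
  `σ > 0` (finite Euler product of the local series `Σ_ν τ_j(q^ν)q^{−νσ}`, `τ_j(q^ν) ≤ (ν+1)^j`);
* `exists_kappaTilde1_majorant` — a summable majorant of the terms of `κ̃₁(d₁;r,·)`, uniform on
  `{σ₀ ≤ σ}` (`|κ₁(d₁h)| ≤ τ₃(d₁h) ≤ τ₃(d₁)τ₃(h)`);
* `differentiableOn_kappaTilde1` — **`κ̃₁(d₁;r,·)` is holomorphic on `{σ₀ < σ}`** (locally uniform
  limit, as `Section7ContourShift.differentiableOn_kappaTilde` for the §7 twin `κ̃`);
* `norm_kappaTilde1_le` — `‖κ̃₁(d₁;r,s)‖ ≤ τ₃(d₁)·Σ_{h∈𝔫(d₁)} τ₃(h)h^{−σ₀}` for `σ ≥ σ₀`.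

Theorems only; 0 definitions; no kit.

## References

* Y. Zhang, arXiv:2211.02515v1 (2022), §15 (15.9) and p. 82, tex L4120–L4136. [cite: Zhang2022LandauSiegel, §15 (15.9), p.82]
-/

noncomputable section

open Complex Real

namespace Literature.NumberTheory.LFunctions.Zhang2022.Typed.Section15A

open Literature.NumberTheory.LFunctions.Zhang2022.Skeleton
open Literature.NumberTheory.LFunctions.Zhang2022.MeanSquareMajorant (tau)

/-! ## A summable majorant over `𝔫(S)` -/

/-- **`Σ_{h∈𝔫(S)} τ_j(h)h^{−σ} < ∞`** for a finite set `S` and `σ > 0`: the finite Euler product over the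
primes of `S` of the local series `Σ_ν τ_j(q^ν)q^{−νσ}`, which converge since `τ_j(q^ν) ≤ (ν+1)^j` and
`q^{−σ} < 1` (the Euler-product bookkeeping behind (15.9)'s `h ∈ 𝔫(d₁)` sums).
[cite: Zhang2022LandauSiegel, §15 (15.9) p.82] -/
theorem summable_tau_rpow_factoredNumbers (j : ℕ) {σ : ℝ} (hσ : 0 < σ) (S : Finset ℕ) :
    Summable ((Nat.factoredNumbers S).indicator fun h : ℕ => tau j h * (h : ℝ) ^ (-σ)) := by
  set F : ℕ → ℝ := fun h => tau j h * (h : ℝ) ^ (-σ) with hF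
  have hF1 : F 1 = 1 := by
    simp only [hF, MeanSquareMajorant.tau_apply_one, Nat.cast_one, Real.one_rpow, mul_one]
  have hmul : ∀ {a b : ℕ}, Nat.Coprime a b → F (a * b) = F a * F b := fun {a b} hab => by
    simp only [hF]
    rw [(MeanSquareMajorant.isMultiplicative_tau j).map_mul_of_coprime hab, Nat.cast_mul,
      Real.mul_rpow (Nat.cast_nonneg a) (Nat.cast_nonneg b)]
    ring
  have hsum : ∀ {q : ℕ}, q.Prime → Summable fun e : ℕ => ‖F (q ^ e)‖ := by
    intro q hq
    have hq2 : (2 : ℝ) ≤ q := by exact_mod_cast hq.two_le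
    set x : ℝ := (q : ℝ) ^ (-σ) with hx
    have hx0 : 0 ≤ x := Real.rpow_nonneg (by linarith) _
    have hx1 : x < 1 := by
      rw [hx, Real.rpow_neg (by linarith), inv_lt_one_iff₀]
      right
      exact Real.one_lt_rpow (by linarith) hσ
    have hxn : ‖x‖ < 1 := by rw [Real.norm_of_nonneg hx0]; exact hx1
    -- majorant `(e+1)^j x^e`, summable
    have hxpos : 0 < x := Real.rpow_pos_of_pos (by linarith) _
    have hg : Summable fun e : ℕ => ((e : ℝ) + 1) ^ j * x ^ e := by
      have h0 : Summable (fun n : ℕ => (n : ℝ) ^ j * x ^ n) :=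
        summable_pow_mul_geometric_of_norm_lt_one j hxn
      have h1 : Summable (fun e : ℕ => ((e + 1 : ℕ) : ℝ) ^ j * x ^ (e + 1)) :=
        (summable_nat_add_iff (f := fun n : ℕ => (n : ℝ) ^ j * x ^ n) 1).mpr h0
      have h2 := h1.mul_left x⁻¹
      refine h2.congr fun e => ?_
      have he : ((e + 1 : ℕ) : ℝ) = (e : ℝ) + 1 := by push_cast; ring
      rw [he, pow_succ, ← mul_assoc, ← mul_assoc, mul_comm (x⁻¹ * ((e : ℝ) + 1) ^ j) (x ^ e)]
      rw [show x ^ e * (x⁻¹ * ((e : ℝ) + 1) ^ j) * x = ((e : ℝ) + 1) ^ j * x ^ e * (x⁻¹ * x) by ring,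
        inv_mul_cancel₀ hxpos.ne', mul_one]
    refine Summable.of_nonneg_of_le (fun e => norm_nonneg _) (fun e => ?_) hg
    rw [hF, Real.norm_of_nonneg (mul_nonneg (MeanSquareMajorant.tau_nonneg _ _)
      (Real.rpow_nonneg (Nat.cast_nonneg _) _))]
    have hloc : ((q ^ e : ℕ) : ℝ) ^ (-σ) = x ^ e := by
      rw [hx, Nat.cast_pow, ← Real.rpow_natCast, ← Real.rpow_mul (by linarith), mul_comm,
        Real.rpow_mul (by linarith), Real.rpow_natCast]
    rw [hloc]
    exact mul_le_mul_of_nonneg_right (MeanSquareMajorant.tau_prime_pow_le j hq e) (pow_nonneg hx0 _)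
  have key := (EulerProduct.summable_and_hasSum_factoredNumbers_prod_filter_prime_tsum hF1 hmul hsum S).2
  exact (hasSum_subtype_iff_indicator.mp key).summable

variable (c' : ℝ) {D : ℕ} (χ : DirichletCharacter ℂ D)

open scoped Classical in
/-- **A summable majorant of the terms of `κ̃₁(d₁;r,·)`, uniform on `{σ₀ ≤ σ}`** (`σ₀ > 0`):
`u(h) = τ₃(d₁)·𝟙_{𝔫(d₁)}(h)·τ₃(h)h^{−σ₀}` (`|κ₁(d₁h)χ(h)h^{−s}| ≤ τ₃(d₁h)h^{−σ} ≤ τ₃(d₁)τ₃(h)h^{−σ₀}`).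
[cite: Zhang2022LandauSiegel, §15 (15.9)] -/
theorem exists_kappaTilde1_majorant {d₁ : ℕ} (hd₁ : d₁ ≠ 0) (r : ℕ) {σ₀ : ℝ} (hσ₀ : 0 < σ₀) :
    ∃ u : ℕ → ℝ, Summable u ∧ (∀ h, 0 ≤ u h) ∧
      ∀ (h : ℕ) (s : ℂ), σ₀ ≤ s.re →
        ‖(if h ∈ nset d₁ ∧ Nat.Coprime h r then
            kappa1 c' D (d₁ * h) * χ (h : ZMod D) / (h : ℂ) ^ s else 0)‖ ≤ u h := by
  set G : ℕ → ℝ := fun h => tau 3 h * (h : ℝ) ^ (-σ₀) with hG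
  have hsumG := summable_tau_rpow_factoredNumbers 3 hσ₀ d₁.primeFactors
  set u : ℕ → ℝ := fun h => tau 3 d₁ * (Nat.factoredNumbers d₁.primeFactors).indicator G h with hu
  have hG0 : ∀ h, 0 ≤ G h := fun h =>
    mul_nonneg (MeanSquareMajorant.tau_nonneg _ _) (Real.rpow_nonneg (Nat.cast_nonneg _) _)
  have hu0 : ∀ h, 0 ≤ u h := fun h => mul_nonneg (MeanSquareMajorant.tau_nonneg _ _)
    (Set.indicator_nonneg (fun _ _ => hG0 _) _)
  refine ⟨u, hsumG.mul_left _, hu0, fun h s hs => ?_⟩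
  by_cases hh : h ∈ nset d₁ ∧ Nat.Coprime h r
  · have h0 : h ≠ 0 := hh.1.1.ne'
    have hmem : h ∈ Nat.factoredNumbers d₁.primeFactors :=
      Nat.mem_factoredNumbers_iff_primeFactors_subset.mpr ⟨h0, fun q hq => by
        have hq' := Nat.mem_primeFactors.mp hq
        exact Nat.mem_primeFactors.mpr ⟨hq'.1, hh.1.2 q hq'.1 hq'.2.1, hd₁⟩⟩
    rw [if_pos hh]
    simp only [hu, Set.indicator_of_mem hmem, hG]
    have hh0 : 0 < h := Nat.pos_of_ne_zero h0
    rw [norm_div, norm_mul, Complex.norm_natCast_cpow_of_pos hh0]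
    have hh1 : (1 : ℝ) ≤ h := by exact_mod_cast hh0
    have hχ : ‖χ (h : ZMod D)‖ ≤ 1 := DirichletCharacter.norm_le_one _ _
    have hκ : ‖kappa1 c' D (d₁ * h)‖ ≤ tau 3 d₁ * tau 3 h :=
      (norm_kappa1_le_tau c' D (d₁ * h)).trans (MeanSquareMajorant.tau_mul_le 3 d₁ h)
    have hexp : ((h : ℝ) ^ s.re)⁻¹ ≤ (h : ℝ) ^ (-σ₀) := by
      rw [← Real.rpow_neg (Nat.cast_nonneg h)]
      exact Real.rpow_le_rpow_of_exponent_le hh1 (by linarith)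
    rw [div_eq_mul_inv]
    calc ‖kappa1 c' D (d₁ * h)‖ * ‖χ (h : ZMod D)‖ * ((h : ℝ) ^ s.re)⁻¹
        ≤ tau 3 d₁ * tau 3 h * 1 * (h : ℝ) ^ (-σ₀) :=
          mul_le_mul (mul_le_mul hκ hχ (norm_nonneg _)
            (mul_nonneg (MeanSquareMajorant.tau_nonneg _ _) (MeanSquareMajorant.tau_nonneg _ _)))
            hexp (inv_nonneg.mpr (Real.rpow_nonneg (Nat.cast_nonneg _) _))
            (by rw [mul_one]; exact mul_nonneg (MeanSquareMajorant.tau_nonneg _ _)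
                  (MeanSquareMajorant.tau_nonneg _ _))
      _ = tau 3 d₁ * (tau 3 h * (h : ℝ) ^ (-σ₀)) := by ring
  · rw [if_neg hh, norm_zero]
    exact hu0 h

open scoped Classical in
/-- **`κ̃₁(d₁;r,·)` is holomorphic on `{σ₀ < σ}`** for every `σ₀ > 0` (in particular on `σ > 9/10`,
the region of the u021 contour step): locally uniform limit of its partial sums
(`differentiableOn_tsum_of_summable_norm`). [cite: Zhang2022LandauSiegel, §15 (15.9), p.82] -/
theorem differentiableOn_kappaTilde1 {d₁ : ℕ} (hd₁ : d₁ ≠ 0) (r : ℕ) {σ₀ : ℝ} (hσ₀ : 0 < σ₀) :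
    DifferentiableOn ℂ (kappaTilde1 c' χ d₁ r) {s : ℂ | σ₀ < s.re} := by
  obtain ⟨u, hu, -, hle⟩ := exists_kappaTilde1_majorant c' χ hd₁ r hσ₀
  have hopen : IsOpen {s : ℂ | σ₀ < s.re} := isOpen_lt continuous_const Complex.continuous_re
  have h := differentiableOn_tsum_of_summable_norm (U := {s : ℂ | σ₀ < s.re})
    (F := fun (h : ℕ) (s : ℂ) => if h ∈ nset d₁ ∧ Nat.Coprime h r then
      kappa1 c' D (d₁ * h) * χ (h : ZMod D) / (h : ℂ) ^ s else 0) hu ?_ hopen ?_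
  · refine h.congr fun s _ => ?_
    simp only [kappaTilde1]
  · intro h
    by_cases hh : h ∈ nset d₁ ∧ Nat.Coprime h r
    · simp only [if_pos hh]
      intro s _
      have h0 : (h : ℂ) ≠ 0 := Nat.cast_ne_zero.mpr hh.1.1.ne'
      have hne : (h : ℂ) ^ s ≠ 0 := fun hz => h0 ((cpow_eq_zero_iff _ _).mp hz).1
      exact ((differentiableAt_const _).div (differentiableAt_id.const_cpow (Or.inl h0))
        hne).differentiableWithinAt
    · simp only [if_neg hh]
      exact differentiableOn_const _
  · intro h s hs
    exact hle h s (le_of_lt hs)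

open scoped Classical in
/-- **`‖κ̃₁(d₁;r,s)‖ ≤ τ₃(d₁)·Σ_{h∈𝔫(d₁)} τ₃(h)h^{−σ₀}`** for `σ ≥ σ₀ > 0` (the bound `M`-factor of the
u021 contour step; the right side is a finite Euler product over the primes of `d₁`).
[cite: Zhang2022LandauSiegel, §15 (15.9), p.82] -/
theorem norm_kappaTilde1_le {d₁ : ℕ} (hd₁ : d₁ ≠ 0) (r : ℕ) {σ₀ : ℝ} (hσ₀ : 0 < σ₀) (s : ℂ)
    (hs : σ₀ ≤ s.re) :
    ‖kappaTilde1 c' χ d₁ r s‖ ≤ tau 3 d₁ *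
      ∑' h : ℕ, (Nat.factoredNumbers d₁.primeFactors).indicator
        (fun h : ℕ => tau 3 h * (h : ℝ) ^ (-σ₀)) h := by
  have hsumG := summable_tau_rpow_factoredNumbers 3 hσ₀ d₁.primeFactors
  -- the same majorant as in `exists_kappaTilde1_majorant`, written out
  set u : ℕ → ℝ := fun h => tau 3 d₁ * (Nat.factoredNumbers d₁.primeFactors).indicator
    (fun h : ℕ => tau 3 h * (h : ℝ) ^ (-σ₀)) h with hu
  have hu0 : ∀ h, 0 ≤ u h := fun h => mul_nonneg (MeanSquareMajorant.tau_nonneg _ _)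
    (Set.indicator_nonneg (fun _ _ => mul_nonneg (MeanSquareMajorant.tau_nonneg _ _)
      (Real.rpow_nonneg (Nat.cast_nonneg _) _)) _)
  have hle : ∀ h : ℕ, ‖(if h ∈ nset d₁ ∧ Nat.Coprime h r then
      kappa1 c' D (d₁ * h) * χ (h : ZMod D) / (h : ℂ) ^ s else 0)‖ ≤ u h := by
    intro h
    by_cases hh : h ∈ nset d₁ ∧ Nat.Coprime h r
    · have h0 : h ≠ 0 := hh.1.1.ne'
      have hmem : h ∈ Nat.factoredNumbers d₁.primeFactors :=
        Nat.mem_factoredNumbers_iff_primeFactors_subset.mpr ⟨h0, fun q hq => by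
          have hq' := Nat.mem_primeFactors.mp hq
          exact Nat.mem_primeFactors.mpr ⟨hq'.1, hh.1.2 q hq'.1 hq'.2.1, hd₁⟩⟩
      rw [if_pos hh]
      simp only [hu, Set.indicator_of_mem hmem]
      have hh0 : 0 < h := Nat.pos_of_ne_zero h0
      rw [norm_div, norm_mul, Complex.norm_natCast_cpow_of_pos hh0]
      have hh1 : (1 : ℝ) ≤ h := by exact_mod_cast hh0
      have hχ : ‖χ (h : ZMod D)‖ ≤ 1 := DirichletCharacter.norm_le_one _ _
      have hκ : ‖kappa1 c' D (d₁ * h)‖ ≤ tau 3 d₁ * tau 3 h :=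
        (norm_kappa1_le_tau c' D (d₁ * h)).trans (MeanSquareMajorant.tau_mul_le 3 d₁ h)
      have hexp : ((h : ℝ) ^ s.re)⁻¹ ≤ (h : ℝ) ^ (-σ₀) := by
        rw [← Real.rpow_neg (Nat.cast_nonneg h)]
        exact Real.rpow_le_rpow_of_exponent_le hh1 (by linarith)
      rw [div_eq_mul_inv]
      have ht0 : 0 ≤ tau 3 d₁ * tau 3 h :=
        mul_nonneg (MeanSquareMajorant.tau_nonneg _ _) (MeanSquareMajorant.tau_nonneg _ _)
      calc ‖kappa1 c' D (d₁ * h)‖ * ‖χ (h : ZMod D)‖ * ((h : ℝ) ^ s.re)⁻¹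
          ≤ tau 3 d₁ * tau 3 h * 1 * (h : ℝ) ^ (-σ₀) :=
            mul_le_mul (mul_le_mul hκ hχ (norm_nonneg _) ht0) hexp
              (inv_nonneg.mpr (Real.rpow_nonneg (Nat.cast_nonneg _) _))
              (by rw [mul_one]; exact ht0)
        _ = tau 3 d₁ * (tau 3 h * (h : ℝ) ^ (-σ₀)) := by ring
    · rw [if_neg hh, norm_zero]
      exact hu0 h
  have husum : Summable u := hsumG.mul_left _
  have hsumm : Summable fun h : ℕ => ‖(if h ∈ nset d₁ ∧ Nat.Coprime h r then
      kappa1 c' D (d₁ * h) * χ (h : ZMod D) / (h : ℂ) ^ s else 0)‖ :=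
    Summable.of_nonneg_of_le (fun _ => norm_nonneg _) hle husum
  unfold kappaTilde1
  refine (norm_tsum_le_tsum_norm hsumm).trans ((Summable.tsum_le_tsum hle hsumm husum).trans ?_)
  rw [hu, tsum_mul_left]

end Literature.NumberTheory.LFunctions.Zhang2022.Typed.Section15A
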